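import Mathlib
import Literature.Topology.FourManifolds.ImmersionCriterion
import HarnessLib

/-!
# Immersions of curves into a `4`-manifold with boundary through a boundary chart

Topic `Literature/Geometry/Symplectic`; infrastructure (brick **T2**) for the proof of the named fact
`Literature.Geometry.Symplectic.Gompf1998_addLeftTwists` (`LegendrianRealisation.lean`; Gompf
1998, §1), where a knot in the boundary `∂W` of a Stein domain is modified inside one boundary
chart and the modified map `S¹ → W` must again be a smooth embedding
(`Manifold.IsSmoothEmbedding`), i.e. an immersion in Mathlib's chart sense
(`Manifold.IsImmersionAtOfComplement`).  The tree's immersion criterion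
(`Literature.Topology.FourManifolds.isImmersionAtOfComplement_of_injective_mfderiv`) is for
boundaryless targets; here the target has boundary and the curve lies *in* the boundary, read
through a boundary chart.  Everything is **proved**; no named facts.

## Contents (namespace `Literature.Geometry.Symplectic.LegendrianDarboux`)

* `L3 : ℝ³ →L ℝ⁴`, `v ↦ (0, v)`, `proj3 : ℝ⁴ →L ℝ³`, `e0` the inward normal, the splitting
  `splitEquiv : ℝ⁴ ≃L ℝ × ℝ³`;
* `slice χ y₀` — the **slice extension** of a partial homeomorphism `χ` of `ℝ³` based at a
  hyperplane point `y₀`: `y ↦ (y - y₀)₀ e₀ + (0, χ (proj3 (y - y₀)))`, a partial homeomorphism of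
  `ℝ⁴` fixing the normal coordinate, smooth when `χ` is;
* `halfRestr` — restriction of a normal-coordinate-preserving partial homeomorphism of `ℝ⁴` to the
  closed half-space model `EuclideanHalfSpace 4`, `C^∞` in the manifold sense
  (`contMDiffOn_halfSpace`);
* `sliceChart p χ hy₀` — the chart at `p` followed by the restricted slice extension; it lies in
  the maximal atlas when `χ` is a local diffeomorphism (`sliceChart_mem_maximalAtlas`, Mathlib's
  `OpenPartialHomeomorph.mem_maximalAtlas_of_contMDiffOn`);
* **`isImmersionAtOfComplement_through_chart`** — if `g : M → ℝ³` is an immersion at `u` with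
  complement `F` and `f : M → W` agrees near `u` with `u' ↦ (extChartAt p)⁻¹ (y₀ + (0, g u'))`
  (the hyperplane points lying in the chart target), then `f` is an immersion at `u` with
  complement `F × ℝ`: in the chart of `M` straightening `g` and the sliced boundary chart, `f`
  reads `t ↦ sliceEquiv L (t, 0)`;
* `isImmersionAtOfComplement_euclidean` — every complement of a curve in a `4`-manifold is `ℝ³`
  (dimension count), so all immersion witnesses can be taken with complement `ℝ³`
  (`…_of_isSmoothEmbedding`, `…_through_chart_of_injective_mfderiv`).

## References

* J. M. Lee, *Introduction to Smooth Manifolds* (2013), Ch. 4–5 (immersions, slice charts);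
  the half-space variant is folklore. [folklore]
* R. E. Gompf, Ann. of Math. 148 (1998), §1. [Gompf1998]
-/

noncomputable section

open scoped Manifold ContDiff Topology
open Set Function Metric

namespace Literature.Geometry.Symplectic.LegendrianDarboux

/-- `ℝ⁴`. -/
local notation "E4" => EuclideanSpace ℝ (Fin 4)
/-- `ℝ³`. -/
local notation "E3" => EuclideanSpace ℝ (Fin 3)
/-- `ℝ¹`. -/
local notation "E1" => EuclideanSpace ℝ (Fin 1)
/-- The closed half-space model. -/
local notation "ℍ4" => EuclideanHalfSpace 4

/-! ### The boundary hyperplane `{y₀ = 0} ≅ ℝ³` of the model `ℝ⁴` -/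

/-- The linear embedding `ℝ³ → ℝ⁴`, `v ↦ (0, v₀, v₁, v₂)` onto the boundary hyperplane
directions. [folklore] -/
def L3 : E3 →L[ℝ] E4 :=
  (EuclideanSpace.proj (0 : Fin 3)).smulRight (EuclideanSpace.single 1 (1 : ℝ)) +
    (EuclideanSpace.proj (1 : Fin 3)).smulRight (EuclideanSpace.single 2 (1 : ℝ)) +
    (EuclideanSpace.proj (2 : Fin 3)).smulRight (EuclideanSpace.single 3 (1 : ℝ))

/-- The projection `ℝ⁴ → ℝ³`, `y ↦ (y₁, y₂, y₃)`. [folklore] -/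
def proj3 : E4 →L[ℝ] E3 :=
  (EuclideanSpace.proj (1 : Fin 4)).smulRight (EuclideanSpace.single 0 (1 : ℝ)) +
    (EuclideanSpace.proj (2 : Fin 4)).smulRight (EuclideanSpace.single 1 (1 : ℝ)) +
    (EuclideanSpace.proj (3 : Fin 4)).smulRight (EuclideanSpace.single 2 (1 : ℝ))

/-- The inward unit normal `e₀ = (1, 0, 0, 0)` of the model. [folklore] -/
def e0 : E4 := EuclideanSpace.single 0 (1 : ℝ)

/-- Coordinates of the hyperplane embedding. [folklore] -/
@[simp] theorem L3_apply_zero (v : E3) : L3 v 0 = 0 := by simp [L3]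
/-- Coordinates of the hyperplane embedding. [folklore] -/
@[simp] theorem L3_apply_one (v : E3) : L3 v 1 = v 0 := by simp [L3]
/-- Coordinates of the hyperplane embedding. [folklore] -/
@[simp] theorem L3_apply_two (v : E3) : L3 v 2 = v 1 := by simp [L3]
/-- Coordinates of the hyperplane embedding. [folklore] -/
@[simp] theorem L3_apply_three (v : E3) : L3 v 3 = v 2 := by simp [L3]
/-- Coordinates of the projection. [folklore] -/
@[simp] theorem proj3_apply_zero (y : E4) : proj3 y 0 = y 1 := by simp [proj3]
/-- Coordinates of the projection. [folklore] -/
@[simp] theorem proj3_apply_one (y : E4) : proj3 y 1 = y 2 := by simp [proj3]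
/-- Coordinates of the projection. [folklore] -/
@[simp] theorem proj3_apply_two (y : E4) : proj3 y 2 = y 3 := by simp [proj3]
/-- Coordinates of `e₀`. [folklore] -/
@[simp] theorem e0_apply_zero : e0 0 = 1 := by simp [e0]
/-- Coordinates of `e₀`. [folklore] -/
@[simp] theorem e0_apply_one : e0 1 = 0 := by simp [e0]
/-- Coordinates of `e₀`. [folklore] -/
@[simp] theorem e0_apply_two : e0 2 = 0 := by simp [e0]
/-- Coordinates of `e₀`. [folklore] -/
@[simp] theorem e0_apply_three : e0 3 = 0 := by simp [e0]

/-- Vectors of `ℝ⁴` with equal coordinates are equal. [folklore] -/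
theorem euclidean_four_ext {v w : E4} (h0 : v 0 = w 0) (h1 : v 1 = w 1) (h2 : v 2 = w 2)
    (h3 : v 3 = w 3) : v = w := by
  ext i; fin_cases i <;> assumption

/-- `proj3 ∘ L3 = id`. [folklore] -/
@[simp] theorem proj3_L3 (v : E3) : proj3 (L3 v) = v := by
  ext i; fin_cases i <;> simp

/-- `proj3 e₀ = 0`. [folklore] -/
@[simp] theorem proj3_e0 : proj3 e0 = 0 := by
  ext i; fin_cases i <;> simp

/-- A vector of the boundary hyperplane is the embedding of its projection. [folklore] -/
theorem L3_proj3 {y : E4} (hy : y 0 = 0) : L3 (proj3 y) = y :=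
  euclidean_four_ext (by simp [hy]) (by simp) (by simp) (by simp)

/-- Decomposition `y = y₀ e₀ + L3 (proj3 y)`. [folklore] -/
theorem smul_e0_add_L3_proj3 (y : E4) : (y 0) • e0 + L3 (proj3 y) = y :=
  euclidean_four_ext (by simp) (by simp) (by simp) (by simp)

/-- The hyperplane embedding is injective. [folklore] -/
theorem L3_injective : Injective L3 := fun v w h => by
  have := congrArg proj3 h; simpa using this

/-- **The splitting `ℝ⁴ ≃ ℝ × ℝ³`**, `y ↦ (y₀, (y₁, y₂, y₃))`. [folklore] -/
def splitEquiv : E4 ≃L[ℝ] ℝ × E3 :=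
  ContinuousLinearEquiv.equivOfInverse
    ((EuclideanSpace.proj (0 : Fin 4) : E4 →L[ℝ] ℝ).prod proj3)
    ((ContinuousLinearMap.fst ℝ ℝ E3).smulRight e0 + L3.comp (ContinuousLinearMap.snd ℝ ℝ E3))
    (fun y => by simp [smul_e0_add_L3_proj3])
    (fun p => by
      ext
      · simp
      · simp [map_add])

/-- The splitting, evaluated. [folklore] -/
@[simp] theorem splitEquiv_apply (y : E4) : splitEquiv y = (y 0, proj3 y) := rfl

/-- The inverse splitting, evaluated. [folklore] -/
@[simp] theorem splitEquiv_symm_apply (p : ℝ × E3) : splitEquiv.symm p = p.1 • e0 + L3 p.2 := rfl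


/-! ### Slicing a local diffeomorphism of `ℝ³` into one of `ℝ⁴` preserving the half-space -/

section Slice

variable (χ : OpenPartialHomeomorph E3 E3) (y₀ : E4)

/-- **The slice extension** of a partial homeomorphism `χ` of `ℝ³` based at `y₀`:
`y ↦ (y - y₀)₀ e₀ + (0, χ (proj3 (y - y₀)))`.  It fixes the normal coordinate (when `(y₀)₀ = 0`)
and acts by `χ` on the hyperplane through `y₀`. [folklore] -/
def slice : OpenPartialHomeomorph E4 E4 :=
  (((Homeomorph.addRight (-y₀)).toOpenPartialHomeomorph.trans
    splitEquiv.toHomeomorph.toOpenPartialHomeomorph).trans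
    ((OpenPartialHomeomorph.refl ℝ).prod χ)).trans
    splitEquiv.symm.toHomeomorph.toOpenPartialHomeomorph

/-- The slice extension, evaluated. [folklore] -/
theorem slice_apply (y : E4) :
    slice χ y₀ y = ((y - y₀) 0) • e0 + L3 (χ (proj3 (y - y₀))) := by
  simp [slice, sub_eq_add_neg]

/-- The inverse of the slice extension, evaluated. [folklore] -/
theorem slice_symm_apply (y : E4) :
    (slice χ y₀).symm y = ((y 0) • e0 + L3 (χ.symm (proj3 y))) + y₀ := by
  simp [slice, Homeomorph.addRight_symm]

/-- The source of the slice extension. [folklore] -/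
theorem slice_source : (slice χ y₀).source = {y | proj3 (y - y₀) ∈ χ.source} := by
  ext y
  simp [slice, sub_eq_add_neg]

/-- The target of the slice extension. [folklore] -/
theorem slice_target : (slice χ y₀).target = {y | proj3 y ∈ χ.target} := by
  ext y
  simp [slice]

variable {χ y₀}

/-- The slice extension fixes the normal coordinate. [folklore] -/
theorem slice_apply_zero (hy₀ : y₀ 0 = 0) (y : E4) : slice χ y₀ y 0 = y 0 := by
  simp [slice_apply, hy₀]

/-- The inverse slice extension fixes the normal coordinate. [folklore] -/
theorem slice_symm_apply_zero (hy₀ : y₀ 0 = 0) (y : E4) : (slice χ y₀).symm y 0 = y 0 := by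
  simp [slice_symm_apply, hy₀]

/-- On the hyperplane through `y₀` the slice extension is `χ`. [folklore] -/
theorem slice_add_L3 (w : E3) : slice χ y₀ (y₀ + L3 w) = L3 (χ w) := by
  simp [slice_apply]

/-- Hyperplane points over the source of `χ` lie in the source of the slice extension. [folklore] -/
theorem add_L3_mem_slice_source {w : E3} (hw : w ∈ χ.source) : y₀ + L3 w ∈ (slice χ y₀).source := by
  simp [slice_source, hw]

/-- The slice extension is smooth when `χ` is. [folklore] -/
theorem contDiffOn_slice (hχ : ContDiffOn ℝ ∞ χ χ.source) : ContDiffOn ℝ ∞ (slice χ y₀) (slice χ y₀).source := by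
  rw [slice_source]
  have h1 : ContDiffOn ℝ ∞ (fun y : E4 => χ (proj3 (y - y₀))) {y | proj3 (y - y₀) ∈ χ.source} :=
    hχ.comp ((proj3.contDiff.comp (contDiff_id.sub contDiff_const)).contDiffOn) fun y hy => hy
  have h : ContDiffOn ℝ ∞ (fun y : E4 => ((y - y₀) 0) • e0 + L3 (χ (proj3 (y - y₀))))
      {y | proj3 (y - y₀) ∈ χ.source} :=
    ((((EuclideanSpace.proj (𝕜 := ℝ) (0 : Fin 4)).contDiff.comp (contDiff_id.sub contDiff_const)).contDiffOn.smul
      contDiffOn_const)).add (L3.contDiff.comp_contDiffOn h1)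
  exact h.congr fun y _ => slice_apply χ y₀ y

/-- The inverse slice extension is smooth when `χ⁻¹` is. [folklore] -/
theorem contDiffOn_slice_symm (hχ : ContDiffOn ℝ ∞ χ.symm χ.target) :
    ContDiffOn ℝ ∞ (slice χ y₀).symm (slice χ y₀).target := by
  rw [slice_target]
  have h1 : ContDiffOn ℝ ∞ (fun y : E4 => χ.symm (proj3 y)) {y | proj3 y ∈ χ.target} :=
    hχ.comp proj3.contDiff.contDiffOn fun y hy => hy
  have h : ContDiffOn ℝ ∞ (fun y : E4 => ((y 0) • e0 + L3 (χ.symm (proj3 y))) + y₀) {y | proj3 y ∈ χ.target} :=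
    ((((EuclideanSpace.proj (𝕜 := ℝ) (0 : Fin 4)).contDiff.contDiffOn.smul contDiffOn_const)).add
      (L3.contDiff.comp_contDiffOn h1)).add contDiffOn_const
  exact h.congr fun y _ => slice_symm_apply χ y₀ y

end Slice


/-! ### Restricting a normal-coordinate-preserving partial homeomorphism to the half-space -/

section Half

variable (e : OpenPartialHomeomorph E4 E4) (h0 : ∀ y, e y 0 = y 0) (h0' : ∀ y, e.symm y 0 = y 0)

/-- **Restriction to the closed half-space** of a partial homeomorphism of `ℝ⁴` preserving the
normal coordinate. [folklore] -/
def halfRestr : OpenPartialHomeomorph ℍ4 ℍ4 where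
  toFun x := ⟨e x.val, by rw [h0]; exact x.property⟩
  invFun x := ⟨e.symm x.val, by rw [h0']; exact x.property⟩
  source := Subtype.val ⁻¹' e.source
  target := Subtype.val ⁻¹' e.target
  map_source' x hx := e.map_source hx
  map_target' x hx := e.map_target hx
  left_inv' x hx := Subtype.ext (e.left_inv hx)
  right_inv' x hx := Subtype.ext (e.right_inv hx)
  open_source := e.open_source.preimage continuous_subtype_val
  open_target := e.open_target.preimage continuous_subtype_val
  continuousOn_toFun := by
    have hind : Topology.IsInducing (Subtype.val : ℍ4 → E4) := Topology.IsInducing.subtypeVal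
    exact hind.continuousOn_iff.2
      (e.continuousOn.comp continuous_subtype_val.continuousOn fun x hx => hx)
  continuousOn_invFun := by
    have hind : Topology.IsInducing (Subtype.val : ℍ4 → E4) := Topology.IsInducing.subtypeVal
    exact hind.continuousOn_iff.2
      (e.continuousOn_symm.comp continuous_subtype_val.continuousOn fun x hx => hx)

/-- The half-space restriction, evaluated. [folklore] -/
@[simp] theorem halfRestr_apply_coe (x : ℍ4) : (halfRestr e h0 h0' x).val = e x.val := rfl

/-- The inverse half-space restriction, evaluated. [folklore] -/
@[simp] theorem halfRestr_symm_apply_coe (x : ℍ4) : ((halfRestr e h0 h0').symm x).val = e.symm x.val := rfl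

/-- The source of the half-space restriction. [folklore] -/
theorem halfRestr_source : (halfRestr e h0 h0').source = Subtype.val ⁻¹' e.source := rfl

/-- The target of the half-space restriction. [folklore] -/
theorem halfRestr_target : (halfRestr e h0 h0').target = Subtype.val ⁻¹' e.target := rfl

/-- A map of the half-space whose composite with the model is smooth (as a map of `ℝ⁴`, on the
relevant part of the half-space) is `C^∞` in the manifold sense. [folklore] -/
theorem contMDiffOn_halfSpace {f : ℍ4 → ℍ4} {s : Set ℍ4} (hf : ContinuousOn f s) {g : E4 → E4}
    (hg : ContDiffOn ℝ ∞ g (Subtype.val '' s)) (hfg : ∀ x ∈ s, (f x).val = g x.val) :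
    ContMDiffOn (𝓡∂ 4) (𝓡∂ 4) ∞ f s := by
  rw [contMDiffOn_iff]
  refine ⟨hf, fun x y => ?_⟩
  simp only [extChartAt_self_eq]
  have htarget : ∀ z : ℍ4, (extChartAt (𝓡∂ 4) z).target = range (𝓡∂ 4) := fun z => by
    rw [extChartAt_target, chartAt_self_eq, OpenPartialHomeomorph.refl_target, preimage_univ, univ_inter]
  have hsymm : ∀ z : ℍ4, ((extChartAt (𝓡∂ 4) z).symm : E4 → ℍ4) = (𝓡∂ 4).symm := fun z => by
    rw [extChartAt, chartAt_self_eq]; rfl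
  rw [htarget, hsymm]
  refine (hg.mono ?_).congr ?_
  · intro v hv
    exact ⟨(𝓡∂ 4).symm v, hv.2.1, (𝓡∂ 4).right_inv hv.1⟩
  · intro v hv
    show ((f ((𝓡∂ 4).symm v)).val : E4) = g v
    rw [hfg _ hv.2.1]
    congr 1
    exact (𝓡∂ 4).right_inv hv.1

include h0 h0' in
/-- The half-space restriction is `C^∞` when the ambient map is. [folklore] -/
theorem contMDiffOn_halfRestr (he : ContDiffOn ℝ ∞ e e.source) :
    ContMDiffOn (𝓡∂ 4) (𝓡∂ 4) ∞ (halfRestr e h0 h0') (halfRestr e h0 h0').source :=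
  contMDiffOn_halfSpace (halfRestr e h0 h0').continuousOn (he.mono (by
    rintro _ ⟨x, hx, rfl⟩; exact hx)) fun _ _ => rfl

include h0 h0' in
/-- The inverse half-space restriction is `C^∞` when the ambient inverse is. [folklore] -/
theorem contMDiffOn_halfRestr_symm (he : ContDiffOn ℝ ∞ e.symm e.target) :
    ContMDiffOn (𝓡∂ 4) (𝓡∂ 4) ∞ (halfRestr e h0 h0').symm (halfRestr e h0 h0').target :=
  contMDiffOn_halfSpace (halfRestr e h0 h0').continuousOn_symm (he.mono (by
    rintro _ ⟨x, hx, rfl⟩; exact hx)) fun _ _ => rfl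

end Half


/-! ### The codomain chart of a manifold with boundary adapted to a slice -/

section Chart

variable {W : Type*} [TopologicalSpace W] [ChartedSpace ℍ4 W] [IsManifold (𝓡∂ 4) ∞ W]

/-- **The sliced boundary chart**: the chart at `p` followed by the half-space restriction of the
slice extension of `χ` based at `y₀`. [folklore] -/
def sliceChart (p : W) (χ : OpenPartialHomeomorph E3 E3) {y₀ : E4} (hy₀ : y₀ 0 = 0) :
    OpenPartialHomeomorph W ℍ4 :=
  (chartAt ℍ4 p).trans (halfRestr (slice χ y₀) (slice_apply_zero hy₀) (slice_symm_apply_zero hy₀))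

variable {p : W} {χ : OpenPartialHomeomorph E3 E3} {y₀ : E4} {hy₀ : y₀ 0 = 0}

omit [IsManifold (𝓡∂ 4) ∞ W] in
/-- The source of the sliced boundary chart. [folklore] -/
theorem sliceChart_source : (sliceChart p χ hy₀).source =
    (chartAt ℍ4 p).source ∩ (chartAt ℍ4 p) ⁻¹' (Subtype.val ⁻¹' (slice χ y₀).source) := by
  rw [sliceChart, OpenPartialHomeomorph.trans_source]; rfl

omit [IsManifold (𝓡∂ 4) ∞ W] in
/-- The sliced boundary chart, evaluated in the model. [folklore] -/
theorem sliceChart_apply_coe (q : W) : (sliceChart p χ hy₀ q).val = slice χ y₀ (extChartAt (𝓡∂ 4) p q) := rfl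

/-- The sliced boundary chart belongs to the maximal atlas when `χ` is a local diffeomorphism.
[folklore] -/
theorem sliceChart_mem_maximalAtlas (hχ : ContDiffOn ℝ ∞ χ χ.source) (hχ' : ContDiffOn ℝ ∞ χ.symm χ.target) :
    sliceChart p χ hy₀ ∈ IsManifold.maximalAtlas (𝓡∂ 4) ∞ W := by
  set θ := halfRestr (slice χ y₀) (slice_apply_zero hy₀) (slice_symm_apply_zero hy₀) with hθ
  have h1 : ContMDiffOn (𝓡∂ 4) (𝓡∂ 4) ∞ θ θ.source :=
    contMDiffOn_halfRestr _ _ _ (contDiffOn_slice hχ)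
  have h2 : ContMDiffOn (𝓡∂ 4) (𝓡∂ 4) ∞ θ.symm θ.target :=
    contMDiffOn_halfRestr_symm _ _ _ (contDiffOn_slice_symm hχ')
  apply OpenPartialHomeomorph.mem_maximalAtlas_of_contMDiffOn
  · show ContMDiffOn (𝓡∂ 4) (𝓡∂ 4) ∞ (θ ∘ chartAt ℍ4 p) (sliceChart p χ hy₀).source
    rw [sliceChart_source]
    exact h1.comp (contMDiffOn_chart.mono inter_subset_left) fun q hq => hq.2
  · show ContMDiffOn (𝓡∂ 4) (𝓡∂ 4) ∞ ((chartAt ℍ4 p).symm ∘ θ.symm) (sliceChart p χ hy₀).target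
    have ht : (sliceChart p χ hy₀).target = θ.target ∩ θ.symm ⁻¹' (chartAt ℍ4 p).target :=
      OpenPartialHomeomorph.trans_target _ _
    rw [ht]
    exact contMDiffOn_chart_symm.comp (h2.mono inter_subset_left) fun q hq => hq.2

end Chart

/-! ### Immersions into the boundary through a boundary chart -/

section Immersion

variable {W : Type*} [TopologicalSpace W] [ChartedSpace ℍ4 W] [IsManifold (𝓡∂ 4) ∞ W]
  {M : Type*} [TopologicalSpace M] [ChartedSpace E1 M] [IsManifold (𝓡 1) ∞ M]
  {Fg : Type*} [NormedAddCommGroup Fg] [NormedSpace ℝ Fg]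

/-- The complement map `(a, (b, r)) ↦ r e₀ + (0, L (a, b))`. [folklore] -/
def sliceFwd (L : (E1 × Fg) ≃L[ℝ] E3) : (E1 × (Fg × ℝ)) →L[ℝ] E4 :=
  ((ContinuousLinearMap.snd ℝ Fg ℝ).comp (ContinuousLinearMap.snd ℝ E1 (Fg × ℝ))).smulRight e0 +
    L3.comp ((L : (E1 × Fg) →L[ℝ] E3).comp
      ((ContinuousLinearMap.fst ℝ E1 (Fg × ℝ)).prod
        ((ContinuousLinearMap.fst ℝ Fg ℝ).comp (ContinuousLinearMap.snd ℝ E1 (Fg × ℝ)))))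

/-- The inverse of the complement map. [folklore] -/
def sliceBwd (L : (E1 × Fg) ≃L[ℝ] E3) : E4 →L[ℝ] (E1 × (Fg × ℝ)) :=
  ((ContinuousLinearMap.fst ℝ E1 Fg).comp ((L.symm : E3 →L[ℝ] (E1 × Fg)).comp proj3)).prod
    (((ContinuousLinearMap.snd ℝ E1 Fg).comp ((L.symm : E3 →L[ℝ] (E1 × Fg)).comp proj3)).prod
      (EuclideanSpace.proj (0 : Fin 4)))

/-- The complement map, evaluated. [folklore] -/
@[simp] theorem sliceFwd_apply (L : (E1 × Fg) ≃L[ℝ] E3) (q : E1 × (Fg × ℝ)) :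
    sliceFwd L q = q.2.2 • e0 + L3 (L (q.1, q.2.1)) := rfl

/-- The inverse complement map, evaluated. [folklore] -/
@[simp] theorem sliceBwd_apply (L : (E1 × Fg) ≃L[ℝ] E3) (y : E4) :
    sliceBwd L y = ((L.symm (proj3 y)).1, ((L.symm (proj3 y)).2, y 0)) := rfl

/-- The complement equivalence: `(a, (b, r)) ↦ r e₀ + (0, L (a, b))`. [folklore] -/
def sliceEquiv (L : (E1 × Fg) ≃L[ℝ] E3) : (E1 × (Fg × ℝ)) ≃L[ℝ] E4 :=
  ContinuousLinearEquiv.equivOfInverse (sliceFwd L) (sliceBwd L)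
    (fun q => by
      obtain ⟨a, b, r⟩ := q
      simp [map_add])
    (fun y => by simp [smul_e0_add_L3_proj3])

/-- The complement equivalence, evaluated. [folklore] -/
@[simp] theorem sliceEquiv_apply (L : (E1 × Fg) ≃L[ℝ] E3) (a : E1) (b : Fg) (r : ℝ) :
    sliceEquiv L (a, (b, r)) = r • e0 + L3 (L (a, b)) := rfl

omit [IsManifold (𝓡 1) ∞ M] in
/-- **Immersions into the boundary through a boundary chart.**  Let `g : M → ℝ³` be an immersion
at `u` (with complement `Fg`) and let `f : M → W` agree near `u` with
`u' ↦ (extChartAt p)⁻¹ (y₀ + (0, g u'))`, the hyperplane points `y₀ + (0, g u')` lying in the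
chart target near `u` (`(y₀)₀ = 0`).  Then `f` is an immersion at `u` into the manifold with
boundary `W`, with complement `Fg × ℝ`: in the chart of `M` straightening `g` and the sliced
boundary chart of `W`, `f` reads `t ↦ (0, (0, L (t, 0)))`. [folklore] -/
theorem isImmersionAtOfComplement_through_chart {p : W} {g : M → E3} {u : M} {f : M → W}
    {y₀ : E4} (hy₀ : y₀ 0 = 0)
    (hg : Manifold.IsImmersionAtOfComplement Fg (𝓡 1) 𝓘(ℝ, E3) ∞ g u)
    (hmem : ∀ᶠ u' in 𝓝 u, y₀ + L3 (g u') ∈ (extChartAt (𝓡∂ 4) p).target)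
    (hf : f =ᶠ[𝓝 u] fun u' => (extChartAt (𝓡∂ 4) p).symm (y₀ + L3 (g u'))) :
    Manifold.IsImmersionAtOfComplement (Fg × ℝ) (𝓡 1) (𝓡∂ 4) ∞ f u := by
  -- the charts of `g`
  set φ := hg.domChart with hφ
  set χ := hg.codChart with hχ
  set L := hg.equiv with hL
  have hχM := hg.codChart_mem_maximalAtlas
  have hχs : ContDiffOn ℝ ∞ χ χ.source :=
    contMDiffOn_iff_contDiffOn.1 (contMDiffOn_of_mem_maximalAtlas hχM)
  have hχs' : ContDiffOn ℝ ∞ χ.symm χ.target :=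
    contMDiffOn_iff_contDiffOn.1 (contMDiffOn_symm_of_mem_maximalAtlas hχM)
  -- an open set around `u` on which `f` has the prescribed form
  obtain ⟨O, hOsub, hOopen, huO⟩ : ∃ O : Set M, O ⊆ {u' | y₀ + L3 (g u') ∈ (extChartAt (𝓡∂ 4) p).target ∧
      f u' = (extChartAt (𝓡∂ 4) p).symm (y₀ + L3 (g u'))} ∧ IsOpen O ∧ u ∈ O :=
    _root_.eventually_nhds_iff.1 (hmem.and hf)
  set φ' := φ.restr O with hφ'
  have hφ'M : φ' ∈ IsManifold.maximalAtlas (𝓡 1) ∞ M :=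
    restr_mem_maximalAtlas _ hg.domChart_mem_maximalAtlas hOopen
  have hφ's : φ'.source = φ.source ∩ O := by
    rw [hφ', OpenPartialHomeomorph.restr_source, hOopen.interior_eq]
  -- the value of `f` at `u`
  have hfu : f u = (extChartAt (𝓡∂ 4) p).symm (y₀ + L3 (g u)) := (hOsub huO).2
  have hyt : y₀ + L3 (g u) ∈ (extChartAt (𝓡∂ 4) p).target := (hOsub huO).1
  refine Manifold.IsImmersionAtOfComplement.mk_of_continuousAt ?_ (sliceEquiv L) φ' (sliceChart p χ hy₀)
    ?_ ?_ hφ'M (sliceChart_mem_maximalAtlas hχs hχs') ?_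
  · -- continuity of `f` at `u`
    have hc0 : ContinuousAt (fun u' => y₀ + L3 (g u')) u :=
      (continuous_const.continuousAt (x := u)).add (L3.continuous.continuousAt.comp hg.continuousAt)
    have hc : ContinuousAt (fun u' => (extChartAt (𝓡∂ 4) p).symm (y₀ + L3 (g u'))) u :=
      ContinuousAt.comp (f := fun u' => y₀ + L3 (g u')) (continuousAt_extChartAt_symm'' hyt) hc0
    exact hc.congr_of_eventuallyEq hf
  · rw [hφ's]; exact ⟨hg.mem_domChart_source, huO⟩
  · rw [sliceChart_source]
    refine ⟨?_, ?_⟩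
    · rw [hfu, ← extChartAt_source (𝓡∂ 4)]
      exact (extChartAt (𝓡∂ 4) p).map_target hyt
    · show (extChartAt (𝓡∂ 4) p (f u)) ∈ (slice χ y₀).source
      rw [hfu, (extChartAt (𝓡∂ 4) p).right_inv hyt]
      exact add_L3_mem_slice_source (hg.source_subset_preimage_source hg.mem_domChart_source)
  · -- the written form
    intro t ht
    have ht' : t ∈ (φ.extend (𝓡 1)).target := by
      rw [OpenPartialHomeomorph.extend_target] at ht ⊢
      exact ⟨by
        have := ht.1
        rw [mem_preimage, hφ', OpenPartialHomeomorph.restr_target] at this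
        exact this.1, ht.2⟩
    set u' := (φ'.extend (𝓡 1)).symm t with hu'
    have hu'eq : u' = (φ.extend (𝓡 1)).symm t := by
      rw [hu', OpenPartialHomeomorph.extend_coe_symm, OpenPartialHomeomorph.extend_coe_symm, hφ']
      rfl
    have hu's : u' ∈ φ'.source := by
      rw [hu', ← OpenPartialHomeomorph.extend_source (I := 𝓡 1)]
      exact (φ'.extend (𝓡 1)).map_target ht
    rw [hφ's] at hu's
    have hw := hg.writtenInCharts ht'
    simp only [comp_apply] at hw ⊢
    rw [← hu'eq] at hw
    -- `f u'` and its chart image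
    have hfu' : f u' = (extChartAt (𝓡∂ 4) p).symm (y₀ + L3 (g u')) := (hOsub hu's.2).2
    have hyt' : y₀ + L3 (g u') ∈ (extChartAt (𝓡∂ 4) p).target := (hOsub hu's.2).1
    rw [OpenPartialHomeomorph.extend_coe, comp_apply]
    show ((sliceChart p χ hy₀ (f u')).val : E4) = sliceEquiv L (t, 0)
    rw [sliceChart_apply_coe, hfu', (extChartAt (𝓡∂ 4) p).right_inv hyt', slice_add_L3]
    have hgx : χ (g u') = L (t, 0) := by
      rw [← hw, OpenPartialHomeomorph.extend_coe]; rfl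
    rw [hgx]
    show L3 (L (t, 0)) = sliceEquiv L (t, ((0 : Fg × ℝ).1, (0 : Fg × ℝ).2))
    rw [sliceEquiv_apply]; simp

end Immersion


/-! ### Normalising the complement to `ℝ³` -/

section Complement

variable {W : Type*} [TopologicalSpace W] [ChartedSpace ℍ4 W]
  {M : Type*} [TopologicalSpace M] [ChartedSpace E1 M]
  {F : Type*} [NormedAddCommGroup F] [NormedSpace ℝ F]

/-- A complement of `ℝ` in `ℝ⁴` has dimension `3`. [folklore] -/
theorem finrank_complement_eq (L : (E1 × F) ≃L[ℝ] E4) :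
    FiniteDimensional ℝ F ∧ Module.finrank ℝ F = 3 := by
  have hinj : Injective ((L : (E1 × F) →L[ℝ] E4).toLinearMap.comp (LinearMap.inr ℝ E1 F)) := by
    intro a b h
    have := L.injective h
    simpa using this
  haveI : FiniteDimensional ℝ F := Module.Finite.of_injective _ hinj
  refine ⟨this, ?_⟩
  have h := L.toLinearEquiv.finrank_eq
  rw [Module.finrank_prod, finrank_euclideanSpace_fin, finrank_euclideanSpace_fin] at h
  omega

/-- **Any immersion of a curve into a `4`-manifold with boundary has complement `ℝ³`.**
[folklore] -/
theorem isImmersionAtOfComplement_euclidean {f : M → W} {u : M}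
    (h : Manifold.IsImmersionAtOfComplement F (𝓡 1) (𝓡∂ 4) ∞ f u) :
    Manifold.IsImmersionAtOfComplement E3 (𝓡 1) (𝓡∂ 4) ∞ f u := by
  obtain ⟨hfd, hdim⟩ := finrank_complement_eq h.equiv
  haveI := hfd
  have hdim' : Module.finrank ℝ F = Module.finrank ℝ E3 := by rw [hdim, finrank_euclideanSpace_fin]
  exact (Manifold.IsImmersionAtOfComplement.congr_F (ContinuousLinearEquiv.ofFinrankEq hdim')).1 h

/-- A smooth embedding of a curve into a `4`-manifold with boundary is an immersion with
complement `ℝ³` at every point. [folklore] -/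
theorem isImmersionAtOfComplement_euclidean_of_isSmoothEmbedding {f : M → W}
    (h : Manifold.IsSmoothEmbedding (𝓡 1) (𝓡∂ 4) ∞ f) (u : M) :
    Manifold.IsImmersionAtOfComplement E3 (𝓡 1) (𝓡∂ 4) ∞ f u := by
  obtain ⟨F, _, _, hF⟩ := h.1
  exact isImmersionAtOfComplement_euclidean (hF u)

end Complement


section Criterion

variable {W : Type*} [TopologicalSpace W] [ChartedSpace ℍ4 W] [IsManifold (𝓡∂ 4) ∞ W]
  {M : Type*} [TopologicalSpace M] [ChartedSpace E1 M] [IsManifold (𝓡 1) ∞ M]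

/-- **Immersions into the boundary through a boundary chart, from the rank condition**: if
`g : M → ℝ³` is `C^∞` on an open set around `u` with injective differential at `u`, and `f` agrees
near `u` with `u' ↦ (extChartAt p)⁻¹ (y₀ + (0, g u'))` (hyperplane points in the chart target),
then `f` is an immersion at `u` into `W` with complement `ℝ³` (the tree's immersion criterion
`isImmersionAtOfComplement_of_injective_mfderiv` for `g`, then
`isImmersionAtOfComplement_through_chart`). [folklore] -/
theorem isImmersionAtOfComplement_through_chart_of_injective_mfderiv {p : W} {g : M → E3} {u : M}
    {f : M → W} {y₀ : E4} (hy₀ : y₀ 0 = 0) {U : Set M} (hU : IsOpen U) (huU : u ∈ U)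
    (hg : ContMDiffOn (𝓡 1) 𝓘(ℝ, E3) ∞ g U) (hinj : Injective (mfderiv (𝓡 1) 𝓘(ℝ, E3) g u))
    (hmem : ∀ᶠ u' in 𝓝 u, y₀ + L3 (g u') ∈ (extChartAt (𝓡∂ 4) p).target)
    (hf : f =ᶠ[𝓝 u] fun u' => (extChartAt (𝓡∂ 4) p).symm (y₀ + L3 (g u'))) :
    Manifold.IsImmersionAtOfComplement E3 (𝓡 1) (𝓡∂ 4) ∞ f u :=
  isImmersionAtOfComplement_euclidean (isImmersionAtOfComplement_through_chart hy₀
    (Literature.Topology.FourManifolds.isImmersionAtOfComplement_of_injective_mfderiv hU huU hg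
      (by exact_mod_cast le_top) hinj) hmem hf)

end Criterion

end Literature.Geometry.Symplectic.LegendrianDarboux

end
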